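import Mathlib.LinearAlgebra.FiniteDimensional.Lemmas
import Mathlib.LinearAlgebra.Dimension.Constructions
import Mathlib.LinearAlgebra.Matrix.ToLin
import Summits.RiemannHypothesis.RiemannHypothesis.Theses.RuelleBand
import Summits.RiemannHypothesis.RiemannHypothesis.Theorems.RuelleBandCofiniteCriticalLineStubCofiniteWeilCriterion
import Summits.RiemannHypothesis.RiemannHypothesis.Theorems.RuelleBandCofiniteCriticalLineBoundedIndex
import HarnessLib

/-!
# Route `RuelleBand`, crux `CofiniteCriticalLine`, line `cofinite-weil-index-staircase` —
the calibration stub `stub_indexCalibration` (`CofiniteCriticalLine ⟹ BoundedWeilIndex`)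

Registered stub of the skeleton of the line `cofinite-weil-index-staircase` for the crux
`Summit.RiemannHypothesis.RiemannHypothesis.Theses.RuelleBand.CofiniteCriticalLine`
(item stmt-RiemannHypothesis-2064), proved BY NAME with the registered signature.  It is the
CONVERSE CALIBRATION of the line's conditional rung
`cofiniteCriticalLine_of_boundedWeilIndex_of_krein : KreinDefinitization → BoundedWeilIndex →
CofiniteCriticalLine` (`Theorems/RuelleBandCofiniteCriticalLineBoundedIndex.lean`), and it is
unconditional and elementary:

  if only finitely many zeros of `ζ` in the open critical strip lie off the critical line, say
  `N` of them, then Weil's quadratic form `Re Q` (`Q = weilQuadratic`) has negative index `≤ N`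
  uniformly on all windows: every `(N+1)`-tuple of test functions `g₀, …, g_N` has a non-zero
  combination `F = ∑ cᵢ gᵢ` with `Re Q(F) ≥ 0`.

Proof.  Linear algebra (`N + 1` unknowns, `N` equations, `LinearMap.ker_ne_bot_of_finrank_lt`)
gives `c ≠ 0` with `F̂(ρ) = ∑ cᵢ ĝᵢ(ρ) = 0` at each of the `N` off-line zeros.  By the PROVED
explicit formula in zero-side form (`stub_cofiniteWeilCriterion_zeroForm_eq`:
`Q(F) = ∑_ρ m(ρ) F̂(ρ) conj F̂(1 - ρ̄)` over the non-trivial zeros, absolutely convergent,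
`WeilConverse.summable_pairCoeff`), every term is now either `0` (off the line) or
`m(ρ) |F̂(ρ)|² ≥ 0` (on the line `1 - ρ̄ = ρ`), so `Re Q(F) ≥ 0` (`HasSum.nonneg`).  This is the
weak half of Bombieri's index computation (Bombieri 2000, Thm. 8: the negative index of the
zero-side form is exactly half the number of off-line zeros counted with multiplicity; the sharper
constant is not needed here).

Together with the landed rung this makes `BoundedWeilIndex` EQUIVALENT to the crux modulo the
named Literature fact `Literature.Analysis.OperatorTheory.KreinDefinitization` (Kreĭn 1959), recorded
below as `boundedWeilIndex_iff_cofiniteCriticalLine_of_krein` (windowed form, the line's dictionary)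
and `boundedWeilIndex'_iff_cofiniteCriticalLine_of_krein` (window-free form of the sibling lines);
the two bounded-index hypotheses are themselves unconditionally equivalent
(`boundedWeilIndex_iff_boundedWeilIndex'`, every finite tuple of tests lives in one window).

References: E. Bombieri, *Remarks on Weil's quadratic functional in the theory of prime numbers
I*, Rend. Lincei (9) 11 (2000), 183–233, §3 Thm. 1 and §6 Thm. 8; A. Weil (1952).
-/

set_option linter.dupNamespace false

noncomputable section

open Complex MeasureTheory Filter Set
open scoped BigOperators Topology ComplexConjugate

namespace Summit.RiemannHypothesis.RiemannHypothesis.Theorems.RuelleBandCofiniteCriticalLine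

open Literature.NumberTheory.LFunctions

/-- **More unknowns than equations.** A homogeneous linear system `∑ᵢ cᵢ M i k = 0` (`k : κ`) in
the unknowns `c : ι → ℂ` with `card κ < card ι` has a non-zero solution (rank–nullity,
`LinearMap.ker_ne_bot_of_finrank_lt` for `c ↦ c ᵥ* M`). [folklore] -/
theorem stub_indexCalibration_exists_ne_zero_vecMul_eq_zero {ι κ : Type*} [Fintype ι]
    [Fintype κ] (h : Fintype.card κ < Fintype.card ι) (M : ι → κ → ℂ) :
    ∃ c : ι → ℂ, c ≠ 0 ∧ ∀ k, ∑ i, c i * M i k = 0 := by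
  classical
  have hlt : Module.finrank ℂ (κ → ℂ) < Module.finrank ℂ (ι → ℂ) := by
    simpa only [Module.finrank_fintype_fun_eq_card] using h
  obtain ⟨c, hc, hc0⟩ := Submodule.exists_mem_ne_zero_of_ne_bot
    (LinearMap.ker_ne_bot_of_finrank_lt (f := Matrix.vecMulLinear (Matrix.of M)) hlt)
  refine ⟨c, hc0, fun k ↦ ?_⟩
  rw [LinearMap.mem_ker, Matrix.coe_vecMulLinear] at hc
  simpa [Matrix.vecMul, dotProduct] using congr_fun hc k

/-- **Termwise positivity of the zero side once the off-line transforms vanish.** If `F̂(ρ) = 0`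
at every zero `ρ` of `ζ` with `0 < Re ρ < 1`, `Re ρ ≠ 1/2`, then every term
`m(ρ) P_F(ρ) = m(ρ) F̂(ρ) conj F̂(1 - ρ̄)` of the zero-side series `WeilConverse.zeroForm F` has
non-negative real part: off the line it is `0`, on the line `1 - ρ̄ = ρ` and it is
`m(ρ) |F̂(ρ)|²` with `m(ρ) ≥ 1`. [folklore] -/
theorem stub_indexCalibration_term_re_nonneg {F : ℝ → ℂ}
    (hvan : ∀ ρ : ℂ, riemannZeta ρ = 0 → 0 < ρ.re → ρ.re < 1 → ρ.re ≠ 1 / 2 →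
      weilMellin F ρ = 0)
    (ρ : ZetaZeros.riemannZetaNontrivialZeros) :
    0 ≤ ((riemannZetaZeroOrder (ρ : ℂ) : ℂ) * WeilConverse.pairCoeff F ρ).re := by
  have hm : (0 : ℝ) ≤ (riemannZetaZeroOrder (ρ : ℂ) : ℝ) := by
    exact_mod_cast zero_le_one.trans (ZetaZeros.riemannZetaNontrivialZeros.one_le_order ρ.2)
  have hP : 0 ≤ (WeilConverse.pairCoeff F ρ).re := by
    obtain ⟨hζ, h0, h1⟩ := ZetaZeros.riemannZetaNontrivialZeros.mem_iff'.1 ρ.2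
    by_cases hre : (ρ : ℂ).re = 1 / 2
    · have e : 1 - conj (ρ : ℂ) = ρ := by
        apply Complex.ext
        · simp only [sub_re, one_re, conj_re, hre]
          norm_num
        · simp
      rw [WeilConverse.pairCoeff, e, Complex.mul_conj, Complex.ofReal_re]
      exact Complex.normSq_nonneg _
    · rw [WeilConverse.pairCoeff, hvan ρ hζ h0 h1 hre, zero_mul, Complex.zero_re]
  rw [← Complex.ofReal_intCast, Complex.re_ofReal_mul]
  exact mul_nonneg hm hP

/-- **`Re Q(F) ≥ 0` once the off-line transforms vanish.** For a test function `F` with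
`F̂(ρ) = 0` at every off-line zero `ρ` of `ζ` in the open strip, `0 ≤ Re Q(F)`:
`Q(F) = WeilConverse.zeroForm F` (the PROVED explicit formula in zero-side form,
`stub_cofiniteWeilCriterion_zeroForm_eq`), the series converges absolutely
(`WeilConverse.summable_pairCoeff`) and its terms have non-negative real parts
(`stub_indexCalibration_term_re_nonneg`). [cite: Bombieri2000Weil, Thm. 2] -/
theorem stub_indexCalibration_re_weilQuadratic_nonneg {F : ℝ → ℂ} (hF : IsWeilTest F)
    (hvan : ∀ ρ : ℂ, riemannZeta ρ = 0 → 0 < ρ.re → ρ.re < 1 → ρ.re ≠ 1 / 2 →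
      weilMellin F ρ = 0) :
    0 ≤ (weilQuadratic F).re := by
  rw [← stub_cofiniteWeilCriterion_zeroForm_eq hF]
  exact (Complex.hasSum_re (WeilConverse.summable_pairCoeff hF).hasSum).nonneg
    (stub_indexCalibration_term_re_nonneg hvan)

/-- A finite linear combination `F = ∑ᵢ cᵢ gᵢ` of test functions is a test function and
`F̂(z) = ∑ᵢ cᵢ ĝᵢ(z)` (`stub_cofiniteWeilCriterion_isWeilTest_sum`,
`stub_cofiniteWeilCriterion_weilMellin_sum`, `weilMellin_const_mul`). [folklore] -/
theorem stub_indexCalibration_linearCombination {n : ℕ} (g : Fin n → ℝ → ℂ)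
    (hg : ∀ i, IsWeilTest (g i)) (c : Fin n → ℂ) :
    IsWeilTest (fun t ↦ ∑ i, c i * g i t) ∧
      ∀ z, weilMellin (fun t ↦ ∑ i, c i * g i t) z = ∑ i, c i * weilMellin (g i) z := by
  refine ⟨stub_cofiniteWeilCriterion_isWeilTest_sum (fun i t ↦ c i * g i t) Finset.univ
    fun i _ ↦ (hg i).const_mul (c i), fun z ↦ ?_⟩
  rw [stub_cofiniteWeilCriterion_weilMellin_sum (fun i t ↦ c i * g i t) Finset.univ
    (fun i _ ↦ (hg i).const_mul (c i))]
  exact Finset.sum_congr rfl fun i _ ↦ weilMellin_const_mul (c i) (g i) z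

/-- **The calibration with the explicit constant.** If the set `Z` of zeros of `ζ` with
`0 < Re s < 1`, `Re s ≠ 1/2` is finite with `N` elements, then every `(N+1)`-tuple of test
functions `g` has a non-zero combination `F = ∑ cᵢ gᵢ` with `Re Q(F) ≥ 0`: choose `c ≠ 0` in the
kernel of the `N × (N+1)` system `∑ᵢ cᵢ ĝᵢ(ρ) = 0` (`ρ ∈ Z`,
`stub_indexCalibration_exists_ne_zero_vecMul_eq_zero`), so that `F̂` vanishes on `Z`, and apply
`stub_indexCalibration_re_weilQuadratic_nonneg`.  (Bombieri 2000 Thm. 8 gives the sharp index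
`N/2` counted with multiplicity; not needed.) [cite: Bombieri2000Weil, Thm. 8 (weak half)] -/
theorem stub_indexCalibration_card
    (hfin : {s : ℂ | riemannZeta s = 0 ∧ 0 < s.re ∧ s.re < 1 ∧ s.re ≠ 1 / 2}.Finite)
    (g : Fin (hfin.toFinset.card + 1) → ℝ → ℂ) (hg : ∀ i, IsWeilTest (g i)) :
    ∃ c : Fin (hfin.toFinset.card + 1) → ℂ, c ≠ 0 ∧
      0 ≤ (weilQuadratic (fun t => ∑ i, c i * g i t)).re := by
  obtain ⟨c, hc0, hc⟩ := stub_indexCalibration_exists_ne_zero_vecMul_eq_zero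
    (ι := Fin (hfin.toFinset.card + 1)) (κ := ↥hfin.toFinset) (by simp)
    (fun i ρ ↦ weilMellin (g i) ρ)
  obtain ⟨hF, hMel⟩ := stub_indexCalibration_linearCombination g hg c
  refine ⟨c, hc0, stub_indexCalibration_re_weilQuadratic_nonneg hF fun ρ hζ h0 h1 hre ↦ ?_⟩
  rw [hMel]
  exact hc ⟨ρ, hfin.mem_toFinset.2 ⟨hζ, h0, h1, hre⟩⟩

/-- **Window-free form of the calibration**: `CofiniteCriticalLine ⟹` there is `N` (the number of
off-line zeros) such that every `(N+1)`-tuple of test functions has a non-zero combination with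
`Re Q ≥ 0` — the bounded-index hypothesis of the sibling Weil-index lines
(`cofiniteCriticalLine_of_boundedWeilIndex_of_krein'`). [cite: Bombieri2000Weil, Thm. 8 (weak half)] -/
theorem stub_indexCalibration_windowFree :
    Summit.RiemannHypothesis.RiemannHypothesis.Theses.RuelleBand.CofiniteCriticalLine →
    ∃ N : ℕ, ∀ g : Fin (N + 1) → ℝ → ℂ, (∀ i, IsWeilTest (g i)) →
        ∃ c : Fin (N + 1) → ℂ, c ≠ 0 ∧ 0 ≤ (weilQuadratic (fun t => ∑ i, c i * g i t)).re :=
  fun h ↦ ⟨_, stub_indexCalibration_card h⟩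

/-- **Stub `stub_indexCalibration` — `CofiniteCriticalLine ⟹ BoundedWeilIndex`.** If all but
finitely many zeros of `ζ` in the open critical strip lie on the critical line, then Weil's
quadratic form `Re Q` (`Q = weilQuadratic`) has a UNIFORM bound `N` (the number of off-line zeros)
on its negative index over all windows `[-a, a]`: every `(N+1)`-tuple of test functions supported
in the window has a non-zero combination `F = ∑ cᵢ gᵢ` with `Re Q(F) ≥ 0` (the window hypothesis
is not used).  Proof: `c ≠ 0` with `F̂ = 0` at the `N` off-line zeros (more unknowns than
equations); then every term `m(ρ) F̂(ρ) conj F̂(1 - ρ̄)` of the zero side of the PROVED explicit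
formula `Q(F) = WeilConverse.zeroForm F` is `0` off the line and `m(ρ) |F̂(ρ)|² ≥ 0` on it.
Converse calibration of `cofiniteCriticalLine_of_boundedWeilIndex_of_krein`; unconditional.
[cite: Bombieri2000Weil, Thm. 8 (weak half)] -/
theorem stub_indexCalibration :
    Summit.RiemannHypothesis.RiemannHypothesis.Theses.RuelleBand.CofiniteCriticalLine →
    ∃ N : ℕ, ∀ a : ℝ, ∀ g : Fin (N + 1) → ℝ → ℂ, (∀ i, IsWeilTest (g i)) →
        (∀ i, tsupport (g i) ⊆ Set.Icc (-a) a) →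
        ∃ c : Fin (N + 1) → ℂ, c ≠ 0 ∧ 0 ≤ (weilQuadratic (fun t => ∑ i, c i * g i t)).re := by
  intro h
  obtain ⟨N, hN⟩ := stub_indexCalibration_windowFree h
  exact ⟨N, fun _ g hg _ ↦ hN g hg⟩

/-- **The windowed and the window-free bounded-index hypotheses are equivalent** (unconditionally):
a window hypothesis can be dropped, and conversely every finite tuple of test functions is
supported in one common window `[-a, a]` (compact supports are bounded). [folklore] -/
theorem boundedWeilIndex_iff_boundedWeilIndex' :
    (∃ N : ℕ, ∀ a : ℝ, ∀ g : Fin (N + 1) → ℝ → ℂ, (∀ i, IsWeilTest (g i)) →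
        (∀ i, tsupport (g i) ⊆ Set.Icc (-a) a) →
        ∃ c : Fin (N + 1) → ℂ, c ≠ 0 ∧ 0 ≤ (weilQuadratic (fun t => ∑ i, c i * g i t)).re) ↔
    (∃ N : ℕ, ∀ g : Fin (N + 1) → ℝ → ℂ, (∀ i, IsWeilTest (g i)) →
        ∃ c : Fin (N + 1) → ℂ, c ≠ 0 ∧ 0 ≤ (weilQuadratic (fun t => ∑ i, c i * g i t)).re) := by
  constructor
  · rintro ⟨N, hN⟩
    refine ⟨N, fun g hg ↦ ?_⟩
    -- a common window: each `tsupport (g i)` is compact, hence inside some `[-aᵢ, aᵢ]`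
    have hb : ∀ i, ∃ a : ℝ, tsupport (g i) ⊆ Set.Icc (-a) a := fun i ↦ by
      obtain ⟨a, ha⟩ := ((hg i).2.isCompact.isBounded).subset_closedBall 0
      exact ⟨a, fun t ht ↦ by simpa [Real.closedBall_eq_Icc] using ha ht⟩
    choose a ha using hb
    refine hN (∑ i, |a i|) g hg fun i t ht ↦ ?_
    have hi : |a i| ≤ ∑ j, |a j| :=
      Finset.single_le_sum (f := fun j ↦ |a j|) (fun _ _ ↦ abs_nonneg _) (Finset.mem_univ i)
    obtain ⟨h1, h2⟩ := ha i ht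
    constructor <;> linarith [le_abs_self (a i), neg_abs_le (a i)]
  · rintro ⟨N, hN⟩
    exact ⟨N, fun _ g hg _ ↦ hN g hg⟩

/-- **`BoundedWeilIndex ⟺ CofiniteCriticalLine`, CONDITIONAL on Kreĭn's definitization theorem**
(the unproved named Literature fact `Literature.Analysis.OperatorTheory.KreinDefinitization`, Kreĭn
1959): the forward implication is the landed conditional rung
`cofiniteCriticalLine_of_boundedWeilIndex_of_krein` (uses the fact), the backward one is the
unconditional calibration `stub_indexCalibration`.  Windowed form (the dictionary of the line
`cofinite-weil-index-staircase`). [folklore] -/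
theorem boundedWeilIndex_iff_cofiniteCriticalLine_of_krein :
    Literature.Analysis.OperatorTheory.KreinDefinitization →
    ((∃ N : ℕ, ∀ a : ℝ, ∀ g : Fin (N + 1) → ℝ → ℂ, (∀ i, IsWeilTest (g i)) →
        (∀ i, tsupport (g i) ⊆ Set.Icc (-a) a) →
        ∃ c : Fin (N + 1) → ℂ, c ≠ 0 ∧ 0 ≤ (weilQuadratic (fun t => ∑ i, c i * g i t)).re) ↔
      Summit.RiemannHypothesis.RiemannHypothesis.Theses.RuelleBand.CofiniteCriticalLine) :=
  fun hK ↦ ⟨cofiniteCriticalLine_of_boundedWeilIndex_of_krein hK, stub_indexCalibration⟩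

/-- **Window-free `BoundedWeilIndex ⟺ CofiniteCriticalLine`, CONDITIONAL on Kreĭn's
definitization theorem** (the unproved named Literature fact
`Literature.Analysis.OperatorTheory.KreinDefinitization`): forward by the landed conditional rung
`cofiniteCriticalLine_of_boundedWeilIndex_of_krein'`, backward by the unconditional
`stub_indexCalibration_windowFree`.  This is the typed node shared by all Weil-index lines of the
crux. [folklore] -/
theorem boundedWeilIndex'_iff_cofiniteCriticalLine_of_krein :
    Literature.Analysis.OperatorTheory.KreinDefinitization →
    ((∃ N : ℕ, ∀ g : Fin (N + 1) → ℝ → ℂ, (∀ i, IsWeilTest (g i)) →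
        ∃ c : Fin (N + 1) → ℂ, c ≠ 0 ∧ 0 ≤ (weilQuadratic (fun t => ∑ i, c i * g i t)).re) ↔
      Summit.RiemannHypothesis.RiemannHypothesis.Theses.RuelleBand.CofiniteCriticalLine) :=
  fun hK ↦ ⟨cofiniteCriticalLine_of_boundedWeilIndex_of_krein' hK,
    stub_indexCalibration_windowFree⟩

end Summit.RiemannHypothesis.RiemannHypothesis.Theorems.RuelleBandCofiniteCriticalLine

end
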